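import Mathlib.GroupTheory.PushoutI
import Mathlib.GroupTheory.Perm.Basic
import Mathlib.SetTheory.Cardinal.Finite
import Mathlib.Algebra.Order.BigOperators.GroupWithZero.Finset
import Mathlib.GroupTheory.Index
import Literature.GroupTheory.PermutationGroups.FreeActionExtension
import HarnessLib

/-!
# B. H. Neumann's permutational product: an amalgam of finite groups has a finite permutation
# representation that is faithful on every factor

Topic `Literature/GroupTheory/CombinatorialGroupTheory`; theorems only (no definitions).  For a finite family of
FINITE groups `G i` and a group `H` with INJECTIVE homomorphisms `φ i : H →* G i`, there are a finite
set `Ω` and a homomorphism `ρ : ∗_H G i →* Equiv.Perm Ω` (Mathlib's `Monoid.PushoutI φ`) whose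
restriction to every factor `G i` is a FREE action — in particular injective; hence the kernel of `ρ` is
a normal subgroup of finite index meeting every conjugate of every factor trivially
(`exists_normal_finiteIndex_inf_conj_eq_bot`).  This is B. H. Neumann's "permutational product"
(*An essay on free products of groups with amalgamations*, Phil. Trans. Roy. Soc. A 246 (1954), §5 p. 532;
quoted in P. F. Stebe, Trans. AMS 156 (1971), proof of Lemma 16: "there is a homomorphism `ξ` from `G`
onto a finite group such that the kernel of `ξ` meets each factor of `G` only in the identity").  The
counting fact used — a free action of `H` on a finite set of cardinality divisible by `|G i|` extends
along `φ i` to a free action of `G i` — is the tree's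
`Literature.GroupTheory.PermutationGroups.exists_perm_hom_comp_eq_of_free`.

* `exists_perm_hom_free_on_factors` — `∃ (n : ℕ) (ρ : PushoutI φ →* Perm (Fin n))`, `0 < n`, every factor
  acting FREELY through `ρ`;
* `exists_perm_hom_injective_on_factors` — the same with "injective on every factor";
* `exists_normal_finiteIndex_inf_conj_eq_bot` — a normal subgroup of finite index meeting every conjugate of
  every factor trivially (the input of H. Neumann's theorem / MKS Cor. 4.9.2 that such a subgroup is free).

## References
* B. H. Neumann, *An essay on free products of groups with amalgamations*, Phil. Trans. Roy. Soc. London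
  A 246 (1954) 503–554, §5.
* P. F. Stebe, *Conjugacy separability of certain free products with amalgamation*, Trans. Amer. Math.
  Soc. 156 (1971) 119–129, Lemma 16. [Stebe1971]
* D. E. Cohen, *Combinatorial Group Theory: a topological approach*, LMS Student Texts 14 (1989), Ch. 1
  Props. 22, 33. [CohenCGT1989]
-/

namespace Literature.GroupTheory.CombinatorialGroupTheory

open Monoid Monoid.PushoutI Function Equiv
open Literature.GroupTheory.PermutationGroups

universe u v w

variable {ι : Type u} {G : ι → Type v} [∀ i, Group (G i)] {H : Type w} [Group H]
  {φ : ∀ i, H →* G i}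

/-- **B. H. Neumann's permutational product** (Phil. Trans. A 246 (1954) §5; Stebe 1971, proof of Lemma 16):
for a finite family of finite groups `G i` over a common subgroup `H` (all `φ i` injective) there is a finite
set — here `H × Fin m` with `m = ∏ i, |G i|` — and a homomorphism `ρ` from the amalgam `∗_H G i` to its
permutation group through which EVERY FACTOR ACTS FREELY. [cite: Stebe1971, Lemma 16 p.126] -/
theorem exists_perm_hom_free_on_factors [Fintype ι] [∀ i, Finite (G i)] [Finite H]
    (hφ : ∀ i, Injective (φ i)) :
    ∃ (m : ℕ) (ρ : PushoutI φ →* Perm (H × Fin m)), 0 < m ∧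
      ∀ (i : ι) (g : G i), g ≠ 1 → ∀ y, ρ (of i g) y ≠ y := by
  classical
  let m : ℕ := ∏ i, Nat.card (G i)
  have hm : 0 < m := Finset.prod_pos fun i _ => Nat.card_pos
  -- the free `H`-action on `Ω = H × Fin m`: left multiplication on the first factor
  let κ : H →* Perm (H × Fin m) :=
    { toFun := fun h => Equiv.prodCongr (Equiv.mulLeft h) (Equiv.refl (Fin m))
      map_one' := by ext ⟨x, s⟩ <;> simp
      map_mul' := fun h h' => by ext ⟨x, s⟩ <;> simp [mul_assoc] }
  have hκ : ∀ h : H, h ≠ 1 → ∀ y, κ h y ≠ y := by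
    intro h hh y hy
    have := congrArg Prod.fst hy
    simp [κ] at this
    exact hh this
  -- `|G i|` divides `|Ω| = |H| · m`
  have hdvd : ∀ i, Nat.card (G i) ∣ Nat.card (H × Fin m) := fun i => by
    rw [Nat.card_prod, Nat.card_fin]
    exact Dvd.dvd.mul_left (Finset.dvd_prod_of_mem _ (Finset.mem_univ i)) _
  -- extend along each `φ i` to a free `G i`-action
  have hρ : ∀ i, ∃ ρi : G i →* Perm (H × Fin m), ρi.comp (φ i) = κ ∧
      ∀ g : G i, g ≠ 1 → ∀ y, ρi g y ≠ y := fun i =>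
    exists_perm_hom_comp_eq_of_free (φ i) (hφ i) κ hκ (hdvd i)
  choose ρi hρi hfree using hρ
  refine ⟨m, PushoutI.lift ρi κ hρi, hm, fun i g hg y => ?_⟩
  rw [PushoutI.lift_of]
  exact hfree i g hg y

/-- **B. H. Neumann's permutational product**, injectivity form: a homomorphism from the amalgam of finitely
many finite groups to a FINITE permutation group that is injective on every factor.
[cite: Stebe1971, Lemma 16 p.126] -/
theorem exists_perm_hom_injective_on_factors [Fintype ι] [∀ i, Finite (G i)] [Finite H]
    (hφ : ∀ i, Injective (φ i)) :
    ∃ (m : ℕ) (ρ : PushoutI φ →* Perm (H × Fin m)), ∀ i, Injective (ρ.comp (of i)) := by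
  obtain ⟨m, ρ, hm, hfree⟩ := exists_perm_hom_free_on_factors hφ
  refine ⟨m, ρ, fun i => (injective_iff_map_eq_one _).mpr fun g hg => ?_⟩
  by_contra hne
  haveI : Nonempty (H × Fin m) := ⟨(1, ⟨0, hm⟩)⟩
  obtain ⟨y⟩ := ‹Nonempty (H × Fin m)›
  exact hfree i g hne y (by rw [MonoidHom.comp_apply] at hg; rw [hg]; rfl)

/-- **Stebe 1971, proof of Lemma 16** ("there is a homomorphism `ξ` from `G` onto a finite group such that the
kernel of `ξ` meets each factor of `G` only in the identity"): an amalgam of finitely many finite groups has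
a normal subgroup of finite index meeting EVERY CONJUGATE of every factor trivially.
[cite: Stebe1971, Lemma 16 p.126] -/
theorem exists_normal_finiteIndex_inf_conj_eq_bot [Fintype ι] [∀ i, Finite (G i)] [Finite H]
    (hφ : ∀ i, Injective (φ i)) :
    ∃ N : Subgroup (PushoutI φ), N.Normal ∧ N.FiniteIndex ∧
      ∀ (i : ι) (x : PushoutI φ) (g : G i), x * of i g * x⁻¹ ∈ N → g = 1 := by
  classical
  obtain ⟨m, ρ, hm, hfree⟩ := exists_perm_hom_free_on_factors hφ
  haveI : Finite (Perm (H × Fin m)) := inferInstance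
  refine ⟨ρ.ker, inferInstance, ?_, fun i x g hx => ?_⟩
  · -- finite index: the range of `ρ` lies in the finite group `Perm Ω`
    exact Subgroup.finiteIndex_ker ρ
  · by_contra hg
    rw [MonoidHom.mem_ker, map_mul, map_mul, map_inv] at hx
    -- `ρ (of i g)` is conjugate to the identity, hence the identity; but it acts freely
    have h1 : ρ (of i g) = 1 := by
      have := congrArg (fun p => (ρ x)⁻¹ * p * ρ x) hx
      simpa [mul_assoc] using this
    have y : H × Fin m := (1, ⟨0, hm⟩)
    exact hfree i g hg y (by rw [h1]; rfl)

end Literature.GroupTheory.CombinatorialGroupTheory
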